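import Mathlib.RepresentationTheory.Coinvariants
import Mathlib.RepresentationTheory.Invariants
import Mathlib.LinearAlgebra.Determinant
import Mathlib.LinearAlgebra.Dimension.Finrank
import Mathlib.LinearAlgebra.FiniteDimensional.Lemmas
import Literature.NumberTheory.EllipticCurves.TateModuleUnipotentInertiaProofs
import Literature.NumberTheory.EllipticCurves.WeilPairingProofs
import Literature.NumberTheory.EllipticCurves.HasseWeilGoodReductionFrobenius
import Literature.NumberTheory.EllipticCurves.HasseWeilAbelianBadReduction
import HarnessLib

/-!
# Inertia coinvariants of `V_ℓ E` from the inertia invariants: `dim (V_ℓ E)_{I} = dim (V_ℓ E)^{I}`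
# and the action on the coinvariant line (proofs)

Topic `NumberTheory/EllipticCurves`; sibling proof file (theorems only, D-0014 append protocol:
nothing is defined) of `HasseWeilAbelianBadReduction`, whose three named facts — the structure of
the inertia **co**invariants `(V_ℓ E)_{I_𝔓}` (`ContinuousRep.InertiaCoinvariants`, the space on
which `Literature.NumberTheory.EllipticCurves.hasseWeilEulerFactor` takes the reversed
characteristic polynomial of an arithmetic Frobenius) at the split multiplicative, non-split
multiplicative and additive places `v ∤ ℓ` of an elliptic curve over a number field — are the
remaining inputs of the Euler-factor fact `WeierstrassCurve.hasseWeilEulerFactor_geomPoints`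
(`HasseWeilAbelian`; Silverman, *AEC*, C.§16) now that its good places are discharged
(`hasseWeilEulerFactor_of_hasGoodReduction_holds`).  The tree's programme towards the bad places
(Serre–Tate 1968, §1 Lemma 2: `HasseWeilAbelianInertiaInvariants`, `TateModuleInertiaReductionProofs`,
`KodairaNeronUnramified`, …) computes the inertia **invariants** `(V_ℓ E)^{I_𝔓}`
(`ContinuousRep.fixedSubmodule`; Silverman *ATAEC* Thm. IV.10.2(a),
`codimFixed_inertia_rationalTate_eq_one_of_hasMultiplicativeReductionAt`,
`…_eq_two_of_hasAdditiveReductionAt` of `HasseWeilAbelianConductor`).  This file supplies the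
passage **from invariants to coinvariants**, by linear algebra on the plane `V_ℓ E` on which the
inertia group acts with determinant `1` (`det ρ_{E,ℓ} = χ_ℓ` from the Weil pairing, *AEC*
III.8.1, III.8.3, proved in the tree: `det_galoisRepTate_eq_cyclotomicCharacter`,
`exists_weilPairing_holds`, `det_rationalTateRepresentation_eq_one_of_mem_inertia`):

* `Representation.Coinvariants.finrank_eq_finrank_invariants_of_det_eq_one`: for a representation
  of a group on a plane with all determinants `1`, `dim V_G = dim V^G` — case by case:
  `V^G = V` (trivial action, `Coinvariants.ker_eq_bot_iff`); `V^G` a line (then every `π g` is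
  unipotent, `LinearMap.sub_mem_span_of_det_eq_one` of `TateModuleUnipotentInertiaProofs`, and
  `⟨π g v - v⟩ = V^G`, `Coinvariants.ker_eq_invariants_of_finrank_invariants_eq_one`); `V^G = 0`
  (then `⟨π g v - v⟩ = V`, `Coinvariants.ker_eq_top_of_invariants_eq_bot`, through
  `LinearMap.apply_eq_self_of_forall_sub_mem_span_of_det_eq_one`: a determinant-one plane
  endomorphism moving every vector along `m` fixes `m`);
* `Representation.toCoinvariants_eq_smul_id_of_finrank_invariants_eq_one`: in the unipotent case,
  if `g` (normalising the acting subgroup) acts on the invariant line as `a ≠ 0` and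
  `det g = a c`, it acts on the coinvariant line as `c` (matrix `[[a, x], [0, c]]`);
* `ContinuousRep.invariants_restrictDecomposition_comp_inertia`: the invariants of `ρ|_{I_𝔓}`
  (`I_𝔓 ⊴ D_𝔓`, the representation whose coinvariants are `InertiaCoinvariants`) are
  `ρ.fixedSubmodule (𝔓.inertia G)`;
* for an elliptic curve `E/K` over a number field, `𝔓 ∣ v ∤ ℓ`:
  `WeierstrassCurve.det_rationalTateRepresentation_of_isArithFrobAt` (`det ρ_V(σ) = N v` for an
  arithmetic Frobenius `σ`; *AEC* C.21.3), `det_rationalTateRepresentation_eq_cyclotomicCharacter`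
  (`det ρ_V = χ_ℓ` on `V_ℓ E`), `finrank_inertiaCoinvariants_eq_finrank_fixedSubmodule`
  (**`dim (V_ℓ E)_{I_𝔓} = dim (V_ℓ E)^{I_𝔓}`**), `finrank_inertiaCoinvariants_eq_two_sub_codimFixed`,
  and `toInertiaCoinvariants_eq_smul_id_of_codimFixed_eq_one` (**if `codim (V_ℓ E)^{I_𝔓} = 1` and
  `σ ∈ D_𝔓` acts on the invariant line as `a`, `det ρ(σ) = a c`, then `σ` acts on
  `(V_ℓ E)_{I_𝔓}` as `c`**);
* `WeierstrassCurve.inertiaCoinvariants_rationalTate_eq_zero_of_hasAdditiveReductionAt_of_codim`: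
  **the additive-place fact of `HasseWeilAbelianBadReduction` follows from the additive case of
  *ATAEC* Thm. IV.10.2(a)** (`codim (V_ℓ E)^{I_𝔓} = 2`, `HasseWeilAbelianConductor`).

The multiplicative places need, besides `codim (V_ℓ E)^{I_𝔓} = 1`, the action of Frobenius on the
invariant line; this is vendored (named facts) and assembled in the sibling
`HasseWeilAbelianEulerFactorElliptic`.

## References

* J. H. Silverman, *The Arithmetic of Elliptic Curves*, 2nd ed., GTM 106 (2009): Prop. III.8.1,
  III.8.3 (Weil pairing, `det ρ_ℓ = χ_ℓ`), C.§16 (PDF p. 390), C.21 Remark 21.3.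
  [SilvermanAEC2009]
* J. H. Silverman, *Advanced Topics in the Arithmetic of Elliptic Curves*, GTM 151 (1994), §IV.10
  Definition and Thm. 10.2(a) (PDF pp. 358–359), Exercise 5.13 (PDF p. 416). [SilvermanATAEC1994]
* J.-P. Serre, J. Tate, *Good reduction of abelian varieties*, Ann. of Math. 88 (1968), §1
  Lemma 2 (the reduction isomorphism `A_m^{I} ≅ Ã_m` commutes with `D(v̄)`). [SerreTate1968]

## Design

Pure theorems; `noncomputable section`; the general lemmas are deliberate dot-notation extensions
of Mathlib's `Representation` / `Representation.Coinvariants` namespaces and of the tree's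
`Literature.NumberTheory.EllipticCurves.LinearMap` and
`Literature.NumberTheory.GaloisRepresentations.ContinuousRep` namespaces; the elliptic-curve
statements are dot-notation extensions of Mathlib's `WeierstrassCurve` namespace with one universe
`u` (`K : Type u`), `[W.IsElliptic]` a section instance and continuity `h` of the Galois action on
`V_ℓ E` an explicit hypothesis, as in the sibling files.  The Weil pairings enter through the
tree's theorem `exists_weilPairing_holds` (no hypothesis is left).
-/

noncomputable section

open Module

namespace Literature.NumberTheory.EllipticCurves

/-! ### A determinant-one plane endomorphism moving vectors along a line fixes that line -/

/-- If `dim_k V = 2`, `m ≠ 0`, `f w - w ∈ k m` for every `w` and `det f = 1`, then `f m = m`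
(in a basis `(m, y)` the matrix of `f` is `[[a, x], [0, 1]]` with `a = det f`). [folklore] -/
theorem LinearMap.apply_eq_self_of_forall_sub_mem_span_of_det_eq_one {k V : Type*} [Field k]
    [AddCommGroup V] [Module k V] [FiniteDimensional k V] (h2 : Module.finrank k V = 2)
    (f : V →ₗ[k] V) {m : V} (hm : m ≠ 0) (hmove : ∀ w, f w - w ∈ k ∙ m)
    (hdet : LinearMap.det f = 1) : f m = m := by
  obtain ⟨y, hli⟩ := exists_linearIndependent_pair_of_one_lt_finrank (h2 ▸ one_lt_two) hm
  let b : Module.Basis (Fin 2) k V :=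
    basisOfLinearIndependentOfCardEqFinrank hli (by rw [Fintype.card_fin, h2])
  have hb0 : b 0 = m := by
    simp [b, coe_basisOfLinearIndependentOfCardEqFinrank]
  have hb1 : b 1 = y := by
    simp [b, coe_basisOfLinearIndependentOfCardEqFinrank]
  -- `f m = a • m`
  have hfm : f m ∈ k ∙ m := by
    have := Submodule.add_mem _ (hmove m) (Submodule.mem_span_singleton_self m)
    rwa [sub_add_cancel] at this
  obtain ⟨a, ha⟩ := Submodule.mem_span_singleton.mp hfm
  -- `f y = x • m + y`
  obtain ⟨x, hx⟩ := Submodule.mem_span_singleton.mp (hmove y)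
  have hfy : f y = x • m + y := by rw [hx, sub_add_cancel]
  -- the matrix of `f` in the basis `(m, y)`
  have hM00 : LinearMap.toMatrix b b f 0 0 = a := by
    rw [LinearMap.toMatrix_apply, hb0, ← ha, map_smul, ← hb0, b.repr_self, Finsupp.smul_apply,
      Finsupp.single_eq_same, smul_eq_mul, mul_one]
  have hM10 : LinearMap.toMatrix b b f 1 0 = 0 := by
    rw [LinearMap.toMatrix_apply, hb0, ← ha, map_smul, ← hb0, b.repr_self, Finsupp.smul_apply,
      Finsupp.single_eq_of_ne (by decide), smul_zero]
  have hM11 : LinearMap.toMatrix b b f 1 1 = 1 := by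
    rw [LinearMap.toMatrix_apply, hb1, hfy, map_add, map_smul, ← hb0, ← hb1, b.repr_self,
      b.repr_self, Finsupp.add_apply, Finsupp.smul_apply, Finsupp.single_eq_of_ne (by decide),
      smul_zero, zero_add, Finsupp.single_eq_same]
  have hdet' : a = 1 := by
    have h := LinearMap.det_toMatrix b f
    rw [Matrix.det_fin_two, hM00, hM10, hM11, mul_one, mul_zero, sub_zero, hdet] at h
    exact h
  rw [← ha, hdet', one_smul]

end Literature.NumberTheory.EllipticCurves

/-! ### Coinvariants of a determinant-one representation on a plane -/

namespace Representation

open Literature.NumberTheory.EllipticCurves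

variable {k : Type*} [Field k] {G : Type*} [Group G] {V : Type*} [AddCommGroup V] [Module k V]
  (π : Representation k G V)

/-- The kernel of `V → V_G` vanishes iff `G` acts trivially. [folklore] -/
theorem Coinvariants.ker_eq_bot_iff : Coinvariants.ker π = ⊥ ↔ ∀ g, π g = LinearMap.id := by
  constructor
  · intro h g
    ext v
    have hv : π g v - v ∈ Coinvariants.ker π := Coinvariants.sub_mem_ker g v
    rw [h, Submodule.mem_bot, sub_eq_zero] at hv
    exact hv
  · intro h
    rw [Coinvariants.ker, Submodule.span_eq_bot]
    rintro _ ⟨⟨g, v⟩, rfl⟩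
    simp [h g]

/-- The invariants are everything iff `G` acts trivially. [folklore] -/
theorem invariants_eq_top_iff_forall_eq_id : π.invariants = ⊤ ↔ ∀ g, π g = LinearMap.id := by
  constructor
  · intro h g
    ext v
    have hv : v ∈ π.invariants := h ▸ Submodule.mem_top
    exact (π.mem_invariants v).mp hv g
  · intro h
    rw [eq_top_iff]
    intro v _
    rw [mem_invariants]
    intro g
    rw [h g, LinearMap.id_apply]

variable [FiniteDimensional k V]

/-- On a plane with a non-zero fixed vector `e` and determinants `1`, every `π g` moves vectors
along `e`, so the kernel of `V → V_G` lies in the line `k e`. [folklore] -/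
theorem Coinvariants.ker_le_span_of_det_eq_one (h2 : finrank k V = 2) {e : V} (he : e ≠ 0)
    (hfix : ∀ g, π g e = e) (hdet : ∀ g, LinearMap.det (π g) = 1) :
    Coinvariants.ker π ≤ k ∙ e := by
  rw [Coinvariants.ker, Submodule.span_le]
  rintro _ ⟨⟨g, v⟩, rfl⟩
  exact LinearMap.sub_mem_span_of_det_eq_one h2 (π g) he (hfix g) (hdet g) v

/-- **Unipotent case.**  On a plane with determinants `1`, if the invariants form a line then the
kernel of `V → V_G` *is* that line: `⟨π g v - v⟩ = V^G`. [folklore] -/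
theorem Coinvariants.ker_eq_invariants_of_finrank_invariants_eq_one (h2 : finrank k V = 2)
    (hdet : ∀ g, LinearMap.det (π g) = 1) (h1 : finrank k π.invariants = 1) :
    Coinvariants.ker π = π.invariants := by
  obtain ⟨e, he, he0⟩ := Submodule.exists_mem_ne_zero_of_ne_bot
    (Submodule.one_le_finrank_iff.mp h1.ge)
  have hfix : ∀ g, π g e = e := fun g ↦ (π.mem_invariants e).mp he g
  have hinv : π.invariants = k ∙ e := by
    refine (Submodule.eq_of_le_of_finrank_eq ?_ ?_).symm
    · exact (Submodule.span_singleton_le_iff_mem e _).mpr he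
    · rw [finrank_span_singleton he0, h1]
  have hle : Coinvariants.ker π ≤ k ∙ e :=
    Coinvariants.ker_le_span_of_det_eq_one π h2 he0 hfix hdet
  have hne : Coinvariants.ker π ≠ ⊥ := by
    intro hbot
    have htop : π.invariants = ⊤ :=
      (invariants_eq_top_iff_forall_eq_id π).mpr ((Coinvariants.ker_eq_bot_iff π).mp hbot)
    rw [htop, finrank_top, h2] at h1
    exact absurd h1 (by decide)
  rw [hinv]
  refine Submodule.eq_of_le_of_finrank_eq hle (le_antisymm (Submodule.finrank_mono hle) ?_)
  rw [finrank_span_singleton he0]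
  exact Submodule.one_le_finrank_iff.mpr hne

/-- **No invariants, no coinvariants.**  On a plane with determinants `1`, if `V^G = 0` then the
kernel of `V → V_G` is everything (otherwise it would be a `G`-stable line `k m` with `G` acting
trivially on `V / k m`, and determinant `1` forces `π g m = m`). [folklore] -/
theorem Coinvariants.ker_eq_top_of_invariants_eq_bot (h2 : finrank k V = 2)
    (hdet : ∀ g, LinearMap.det (π g) = 1) (h0 : π.invariants = ⊥) :
    Coinvariants.ker π = ⊤ := by
  by_contra htop
  have hlt : finrank k (Coinvariants.ker π) < 2 := by
    rw [← h2]
    exact Submodule.finrank_lt htop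
  have hne : Coinvariants.ker π ≠ ⊥ := by
    intro hbot
    have htop' : π.invariants = ⊤ :=
      (invariants_eq_top_iff_forall_eq_id π).mpr ((Coinvariants.ker_eq_bot_iff π).mp hbot)
    rw [h0] at htop'
    have h : finrank k (⊥ : Submodule k V) = finrank k (⊤ : Submodule k V) := by rw [htop']
    rw [finrank_bot, finrank_top, h2] at h
    exact absurd h (by decide)
  have h1 : finrank k (Coinvariants.ker π) = 1 := by
    have := Submodule.one_le_finrank_iff.mpr hne
    omega
  obtain ⟨m, hm, hm0⟩ := Submodule.exists_mem_ne_zero_of_ne_bot hne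
  have hker : Coinvariants.ker π = k ∙ m := by
    refine (Submodule.eq_of_le_of_finrank_eq ?_ ?_).symm
    · exact (Submodule.span_singleton_le_iff_mem m _).mpr hm
    · rw [finrank_span_singleton hm0, h1]
  have hmove : ∀ g (w : V), π g w - w ∈ k ∙ m := fun g w ↦ hker ▸ Coinvariants.sub_mem_ker g w
  have hfix : ∀ g, π g m = m := fun g ↦
    LinearMap.apply_eq_self_of_forall_sub_mem_span_of_det_eq_one h2 (π g) hm0 (hmove g) (hdet g)
  have hmem : m ∈ π.invariants := (π.mem_invariants m).mpr hfix
  rw [h0, Submodule.mem_bot] at hmem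
  exact hm0 hmem

/-- **`dim V_G = dim V^G` on a determinant-one plane.**  For a representation of a group on a
plane all of whose determinants are `1`, the coinvariants and the invariants have the same
dimension (`2`, `1`, `0` according as the action is trivial, unipotent non-trivial, or without
fixed vector). [folklore] -/
theorem Coinvariants.finrank_eq_finrank_invariants_of_det_eq_one (h2 : finrank k V = 2)
    (hdet : ∀ g, LinearMap.det (π g) = 1) :
    finrank k (Coinvariants π) = finrank k π.invariants := by
  have hq : finrank k (Coinvariants π) + finrank k (Coinvariants.ker π) = 2 :=
    h2 ▸ Submodule.finrank_quotient_add_finrank (Coinvariants.ker π)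
  have hle : finrank k π.invariants ≤ 2 := h2 ▸ Submodule.finrank_le _
  interval_cases h : finrank k π.invariants
  · have h0 : π.invariants = ⊥ := Submodule.finrank_eq_zero.mp h
    have hk : finrank k (Coinvariants.ker π) = 2 := by
      rw [Coinvariants.ker_eq_top_of_invariants_eq_bot π h2 hdet h0, finrank_top, h2]
    omega
  · have hk : finrank k (Coinvariants.ker π) = 1 := by
      rw [Coinvariants.ker_eq_invariants_of_finrank_invariants_eq_one π h2 hdet h, h]
    omega
  · have htop : π.invariants = ⊤ := Submodule.eq_top_of_finrank_eq (h.trans h2.symm)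
    have hk : finrank k (Coinvariants.ker π) = 0 := by
      rw [(Coinvariants.ker_eq_bot_iff π).mpr ((invariants_eq_top_iff_forall_eq_id π).mp htop),
        finrank_bot]
    omega

/-- **The action on the coinvariant line in the unipotent case.**  Let `ρ` be a representation of
`G` on a plane, `S ⊴ G` acting with determinants `1` and with a line of invariants `V^S`.  If
`g ∈ G` acts on `V^S` as the scalar `a ≠ 0` and `det ρ(g) = a c`, then `g` acts on the
coinvariants `V_S` (a line, `V / V^S`) as the scalar `c` (upper triangular matrix
`[[a, x], [0, c]]` in a basis extending a fixed vector). [folklore] -/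
theorem toCoinvariants_eq_smul_id_of_finrank_invariants_eq_one (ρ : Representation k G V)
    (S : Subgroup G) [S.Normal] (h2 : finrank k V = 2)
    (hdet : ∀ s : S, LinearMap.det (ρ s) = 1)
    (h1 : finrank k (Representation.invariants (ρ.comp S.subtype)) = 1) (g : G) {a c : k}
    (ha0 : a ≠ 0) (ha : ∀ e ∈ Representation.invariants (ρ.comp S.subtype), ρ g e = a • e)
    (hdetg : LinearMap.det (ρ g) = a * c) :
    ρ.toCoinvariants S g = c • LinearMap.id := by
  set π : Representation k S V := ρ.comp S.subtype with hπ
  have hdet' : ∀ s : S, LinearMap.det (π s) = 1 := hdet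
  have hker : Coinvariants.ker π = π.invariants :=
    Coinvariants.ker_eq_invariants_of_finrank_invariants_eq_one π h2 hdet' h1
  obtain ⟨e, he, he0⟩ := Submodule.exists_mem_ne_zero_of_ne_bot
    (Submodule.one_le_finrank_iff.mp h1.ge)
  obtain ⟨y, hli⟩ := exists_linearIndependent_pair_of_one_lt_finrank (h2 ▸ one_lt_two) he0
  let b : Module.Basis (Fin 2) k V :=
    basisOfLinearIndependentOfCardEqFinrank hli (by rw [Fintype.card_fin, h2])
  have hb0 : b 0 = e := by
    simp [b, coe_basisOfLinearIndependentOfCardEqFinrank]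
  have hb1 : b 1 = y := by
    simp [b, coe_basisOfLinearIndependentOfCardEqFinrank]
  have hge : ρ g e = a • e := ha e he
  -- `ρ g y = x • e + d • y`
  set x := b.repr (ρ g y) 0 with hx
  set d := b.repr (ρ g y) 1 with hd
  have hgy : ρ g y = x • e + d • y := by
    have := b.sum_repr (ρ g y)
    rw [Fin.sum_univ_two, hb0, hb1] at this
    exact this.symm
  -- `det ρ(g) = a d`, so `d = c`
  have hdetg' : LinearMap.det (ρ g) = a * d := by
    have hM00 : LinearMap.toMatrix b b (ρ g) 0 0 = a := by
      rw [LinearMap.toMatrix_apply, hb0, hge, ← hb0, map_smul, b.repr_self, Finsupp.smul_apply,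
        Finsupp.single_eq_same, smul_eq_mul, mul_one]
    have hM10 : LinearMap.toMatrix b b (ρ g) 1 0 = 0 := by
      rw [LinearMap.toMatrix_apply, hb0, hge, ← hb0, map_smul, b.repr_self, Finsupp.smul_apply,
        Finsupp.single_eq_of_ne (by decide), smul_zero]
    have hM11 : LinearMap.toMatrix b b (ρ g) 1 1 = d := by
      rw [LinearMap.toMatrix_apply, hb1]
    rw [← LinearMap.det_toMatrix b, Matrix.det_fin_two, hM00, hM10, hM11, mul_zero, sub_zero]
  have hdc : d = c := by
    rw [hdetg'] at hdetg
    exact mul_left_cancel₀ ha0 hdetg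
  -- compare the two maps on the images of `w = α e + β y`
  have hmke : Coinvariants.mk π e = 0 := (Coinvariants.mk_eq_zero π).mpr (hker ▸ he)
  refine Coinvariants.hom_ext (LinearMap.ext fun w ↦ ?_)
  change ρ.toCoinvariants S g (Coinvariants.mk π w) = c • Coinvariants.mk π w
  rw [toCoinvariants_mk]
  change Coinvariants.mk π (ρ g w) = c • Coinvariants.mk π w
  have hw := b.sum_repr w
  rw [Fin.sum_univ_two, hb0, hb1] at hw
  rw [← hw, map_add, map_smul, map_smul, hge, hgy, hdc]
  simp only [map_add, map_smul, hmke, smul_zero, zero_add]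
  rw [smul_comm]

end Representation

/-! ### Inertia invariants and coinvariants of a continuous representation at a prime -/

namespace Literature.NumberTheory.GaloisRepresentations.ContinuousRep

variable {G : Type*} [Group G] [TopologicalSpace G] {A : Type*} [CommRing A] [TopologicalSpace A]
  {M : Type*} [AddCommGroup M] [Module A M] [TopologicalSpace M]
  {S : Type*} [CommRing S] [MulSemiringAction G S]

/-- The invariants of `ρ|_{I_𝔓}` (restriction to `D_𝔓`, then to `I_𝔓 ⊴ D_𝔓`, the representation
whose coinvariants are `ContinuousRep.InertiaCoinvariants`) are the inertia invariants
`M^{I_𝔓} = ρ.fixedSubmodule (𝔓.inertia G)`. [folklore] -/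
theorem invariants_restrictDecomposition_comp_inertia (ρ : ContinuousRep G A M) (𝔓 : Ideal S) :
    Representation.invariants ((ρ.restrictDecomposition 𝔓).comp
        (𝔓.inertia (𝔓.decompositionSubgroup G)).subtype) =
      ρ.fixedSubmodule (𝔓.inertia G) := by
  ext v
  rw [Representation.mem_invariants, ContinuousRep.mem_fixedSubmodule]
  constructor
  · intro h σ hσ
    exact h ⟨⟨σ, Ideal.inertia_le_decompositionSubgroup G 𝔓 hσ⟩, Ideal.coe_mem_inertia.mp hσ⟩
  · intro h σ
    exact h (σ : G) (Ideal.coe_mem_inertia.mpr σ.2)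

end Literature.NumberTheory.GaloisRepresentations.ContinuousRep

namespace WeierstrassCurve

open Literature.NumberTheory.EllipticCurves Literature.NumberTheory.GaloisRepresentations
open scoped NumberField
open Field IsDedekindDomain

universe u

variable {K : Type u} [Field K] [NumberField K] (W : WeierstrassCurve K) (ℓ : ℕ) [Fact ℓ.Prime]

/-- **`det ρ_{E,ℓ}(σ) = N v` on `V_ℓ E` for an arithmetic Frobenius `σ` at `𝔓 ∣ v ∤ ℓ`**
(Silverman, *AEC*, C.21 Remark 21.3, the norm; from the Weil pairing, Prop. III.8.1, III.8.3:
`det ρ_{E,ℓ} = χ_ℓ` at every level `ℓ^{n+1}`, `toZModPow_det_galoisRepTate_eq`, and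
`χ_ℓ(σ) = N v`, `smul_eq_pow_residueCard_of_isArithFrobAt`).  No reduction hypothesis at `v`.
[cite: SilvermanAEC2009, C.21 Remark 21.3, via Prop. III.8.1 and Prop. III.8.3] -/
theorem det_rationalTateRepresentation_of_isArithFrobAt [W.IsElliptic]
    {v : HeightOneSpectrum (𝓞 K)} (hℓ : (ℓ : 𝓞 K) ∉ v.asIdeal)
    {𝔓 : Ideal (absIntegers (𝓞 K) K)} (h𝔓 : 𝔓 ∈ v.primesAbove)
    {σ : absoluteGaloisGroup K} (hσ : IsArithFrobAt (𝓞 K) σ 𝔓) :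
    LinearMap.det (rationalTateRepresentation (absoluteGaloisGroup K) (geomPoints W) ℓ σ) =
      (v.residueCard : ℚ_[ℓ]) := by
  have hℓK : (ℓ : K) ≠ 0 := Nat.cast_ne_zero.mpr (Fact.out : ℓ.Prime).ne_zero
  haveI := module_free_tateModule_holds W ℓ
  haveI := module_finite_tateModule_holds W ℓ
  have hT : LinearMap.det (W.galoisRepTate ℓ σ : W.tateModule ℓ →ₗ[ℤ_[ℓ]] W.tateModule ℓ) =
      (v.residueCard : ℤ_[ℓ]) := by
    refine PadicInt.ext_of_toZModPow.mp fun n ↦ ?_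
    cases n with
    | zero =>
      haveI : Subsingleton (ZMod (ℓ ^ 0)) := ZMod.subsingleton_iff.mpr (pow_zero ℓ)
      exact Subsingleton.elim _ _
    | succ n =>
      rw [toZModPow_det_galoisRepTate_eq W ℓ hℓK n (W.exists_weilPairing_holds _) σ v.residueCard
          (fun t ht ↦ smul_eq_pow_residueCard_of_isArithFrobAt hℓ h𝔓 hσ ht), map_natCast]
  change LinearMap.det ((W.galoisRepTate ℓ σ).baseChange ℚ_[ℓ]) = _
  rw [LinearMap.det_baseChange, hT, map_natCast]

/-- **`det ρ_{E,ℓ} = χ_ℓ` on `V_ℓ E`** (Silverman, *AEC*, Prop. III.8.3 via III.8.1; the tree's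
`det_galoisRepTate_eq_cyclotomicCharacter` on `T_ℓ E`, base-changed to `ℚ_ℓ`).
[cite: SilvermanAEC2009, Prop. III.8.1 and Prop. III.8.3] -/
theorem det_rationalTateRepresentation_eq_cyclotomicCharacter [W.IsElliptic]
    (σ : absoluteGaloisGroup K) :
    LinearMap.det (rationalTateRepresentation (absoluteGaloisGroup K) (geomPoints W) ℓ σ) =
      (((GaloisRep.cyclotomicCharacter K ℓ σ : ℤ_[ℓ]ˣ) : ℤ_[ℓ]) : ℚ_[ℓ]) := by
  have hℓK : (ℓ : K) ≠ 0 := Nat.cast_ne_zero.mpr (Fact.out : ℓ.Prime).ne_zero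
  haveI := module_free_tateModule_holds W ℓ
  haveI := module_finite_tateModule_holds W ℓ
  change LinearMap.det ((W.galoisRepTate ℓ σ).baseChange ℚ_[ℓ]) = _
  rw [LinearMap.det_baseChange, det_galoisRepTate_eq_cyclotomicCharacter W ℓ hℓK
    (fun _ ↦ W.exists_weilPairing_holds _) σ]
  rfl

section Coinvariants

variable [W.IsElliptic]
  (h : Continuous fun x : absoluteGaloisGroup K × RationalTateModule (geomPoints W) ℓ ↦
    rationalTateRepresentation (absoluteGaloisGroup K) (geomPoints W) ℓ x.1 x.2)

/-- `dim_{ℚ_ℓ} V_ℓ E = 2` (Silverman III.7.1, the tree's `finrank_rationalTateModule_eq_two_holds`),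
restated for the carrier of `rationalTateGaloisRepOf`. [folklore] -/
theorem finrank_rationalTateModule_geomPoints_eq_two :
    finrank ℚ_[ℓ] (RationalTateModule (geomPoints W) ℓ) = 2 :=
  finrank_rationalTateModule_eq_two_holds W ℓ (Nat.cast_ne_zero.mpr (Fact.out : ℓ.Prime).ne_zero)

/-- The inertia group `I_𝔓`, `𝔓 ∣ v ∤ ℓ`, acts on `V_ℓ E` with determinant `1` — through the
restriction `ρ|_{D_𝔓}` to the decomposition group (`det ρ_{E,ℓ} = χ_ℓ` is unramified away from
`ℓ`; `det_rationalTateRepresentation_eq_one_of_mem_inertia` with the Weil pairings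
`exists_weilPairing_holds`). [cite: SilvermanAEC2009, Prop. III.8.1 and Prop. III.8.3] -/
theorem det_restrictDecomposition_inertia_eq_one {v : HeightOneSpectrum (𝓞 K)}
    (hℓ : (ℓ : 𝓞 K) ∉ v.asIdeal) {𝔓 : Ideal (absIntegers (𝓞 K) K)} (h𝔓 : 𝔓 ∈ v.primesAbove)
    (s : 𝔓.inertia (𝔓.decompositionSubgroup (absoluteGaloisGroup K))) :
    LinearMap.det ((((rationalTateGaloisRepOf (geomPoints W) ℓ h).restrictDecomposition 𝔓).comp
      (𝔓.inertia (𝔓.decompositionSubgroup (absoluteGaloisGroup K))).subtype :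
        Representation ℚ_[ℓ] _ (RationalTateModule (geomPoints W) ℓ)) s) = 1 :=
  W.det_rationalTateRepresentation_eq_one_of_mem_inertia ℓ (fun _ ↦ W.exists_weilPairing_holds _)
    hℓ h𝔓 (Ideal.coe_mem_inertia.mpr s.2)

/-- **`dim (V_ℓ E)_{I_𝔓} = dim (V_ℓ E)^{I_𝔓}`** for an elliptic curve over a number field at
`𝔓 ∣ v ∤ ℓ`: the inertia coinvariants and invariants of the rational Tate module have the same
dimension, because `I_𝔓` acts on the plane `V_ℓ E` with determinant `1` (Weil pairing)
(`Representation.Coinvariants.finrank_eq_finrank_invariants_of_det_eq_one`).  Equivalently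
`(V_ℓ E)_{I} ≅ ((V_ℓ E)^{I}(-1))^∨` by the self-duality `V_ℓ E ≅ (V_ℓ E)^∨(1)`.
[cite: SilvermanAEC2009, Prop. III.8.1 and Prop. III.8.3] -/
theorem finrank_inertiaCoinvariants_eq_finrank_fixedSubmodule {v : HeightOneSpectrum (𝓞 K)}
    (hℓ : (ℓ : 𝓞 K) ∉ v.asIdeal) {𝔓 : Ideal (absIntegers (𝓞 K) K)} (h𝔓 : 𝔓 ∈ v.primesAbove) :
    finrank ℚ_[ℓ] ((rationalTateGaloisRepOf (geomPoints W) ℓ h).InertiaCoinvariants 𝔓) =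
      finrank ℚ_[ℓ] ((rationalTateGaloisRepOf (geomPoints W) ℓ h).fixedSubmodule
        (𝔓.inertia (absoluteGaloisGroup K))) := by
  haveI : FiniteDimensional ℚ_[ℓ] (RationalTateModule (geomPoints W) ℓ) :=
    finite_rationalTateModule W ℓ
  rw [← ContinuousRep.invariants_restrictDecomposition_comp_inertia]
  exact Representation.Coinvariants.finrank_eq_finrank_invariants_of_det_eq_one _
    (W.finrank_rationalTateModule_geomPoints_eq_two ℓ)
    (fun s ↦ W.det_restrictDecomposition_inertia_eq_one ℓ h hℓ h𝔓 s)

/-- `dim (V_ℓ E)_{I_𝔓} = 2 - codim (V_ℓ E)^{I_𝔓}` (`𝔓 ∣ v ∤ ℓ`). [folklore] -/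
theorem finrank_inertiaCoinvariants_eq_two_sub_codimFixed {v : HeightOneSpectrum (𝓞 K)}
    (hℓ : (ℓ : 𝓞 K) ∉ v.asIdeal) {𝔓 : Ideal (absIntegers (𝓞 K) K)} (h𝔓 : 𝔓 ∈ v.primesAbove) :
    finrank ℚ_[ℓ] ((rationalTateGaloisRepOf (geomPoints W) ℓ h).InertiaCoinvariants 𝔓) =
      2 - (rationalTateGaloisRepOf (geomPoints W) ℓ h).codimFixed
        (𝔓.inertia (absoluteGaloisGroup K)) := by
  haveI : FiniteDimensional ℚ_[ℓ] (RationalTateModule (geomPoints W) ℓ) :=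
    finite_rationalTateModule W ℓ
  rw [W.finrank_inertiaCoinvariants_eq_finrank_fixedSubmodule ℓ h hℓ h𝔓,
    ContinuousRep.codimFixed_eq_finrank_sub, W.finrank_rationalTateModule_geomPoints_eq_two ℓ]
  have := Submodule.finrank_le ((rationalTateGaloisRepOf (geomPoints W) ℓ h).fixedSubmodule
    (𝔓.inertia (absoluteGaloisGroup K)))
  rw [W.finrank_rationalTateModule_geomPoints_eq_two ℓ] at this
  omega

/-- **The action of `D_𝔓` on the coinvariant line from its action on the invariant line.**  If
`codim (V_ℓ E)^{I_𝔓} = 1` (`𝔓 ∣ v ∤ ℓ`) and `σ ∈ D_𝔓` acts on the line `(V_ℓ E)^{I_𝔓}` as the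
scalar `a ≠ 0` with `det ρ_{E,ℓ}(σ) = a c`, then `σ` acts on the line `(V_ℓ E)_{I_𝔓}` as the
scalar `c`: the inertia group acts unipotently, `⟨τx - x⟩ = (V_ℓ E)^{I_𝔓}`, and
`(V_ℓ E)_{I} = V_ℓ E / (V_ℓ E)^{I}`. [folklore] -/
theorem toInertiaCoinvariants_eq_smul_id_of_codimFixed_eq_one {v : HeightOneSpectrum (𝓞 K)}
    (hℓ : (ℓ : 𝓞 K) ∉ v.asIdeal) {𝔓 : Ideal (absIntegers (𝓞 K) K)} (h𝔓 : 𝔓 ∈ v.primesAbove)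
    (hcodim : (rationalTateGaloisRepOf (geomPoints W) ℓ h).codimFixed
      (𝔓.inertia (absoluteGaloisGroup K)) = 1)
    (σ : 𝔓.decompositionSubgroup (absoluteGaloisGroup K)) {a c : ℚ_[ℓ]} (ha0 : a ≠ 0)
    (ha : ∀ e ∈ (rationalTateGaloisRepOf (geomPoints W) ℓ h).fixedSubmodule
        (𝔓.inertia (absoluteGaloisGroup K)),
      rationalTateRepresentation (absoluteGaloisGroup K) (geomPoints W) ℓ
        (σ : absoluteGaloisGroup K) e = a • e)
    (hdetσ : LinearMap.det (rationalTateRepresentation (absoluteGaloisGroup K) (geomPoints W) ℓ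
      (σ : absoluteGaloisGroup K)) = a * c) :
    (rationalTateGaloisRepOf (geomPoints W) ℓ h).toInertiaCoinvariants 𝔓 σ = c • LinearMap.id := by
  haveI : FiniteDimensional ℚ_[ℓ] (RationalTateModule (geomPoints W) ℓ) :=
    finite_rationalTateModule W ℓ
  have h1 : finrank ℚ_[ℓ] (Representation.invariants
      (((rationalTateGaloisRepOf (geomPoints W) ℓ h).restrictDecomposition 𝔓).comp
        (𝔓.inertia (𝔓.decompositionSubgroup (absoluteGaloisGroup K))).subtype)) = 1 := by
    rw [ContinuousRep.invariants_restrictDecomposition_comp_inertia]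
    have hsub := (rationalTateGaloisRepOf (geomPoints W) ℓ h).codimFixed_eq_finrank_sub
      (𝔓.inertia (absoluteGaloisGroup K))
    rw [hcodim, W.finrank_rationalTateModule_geomPoints_eq_two ℓ] at hsub
    have := Submodule.finrank_le ((rationalTateGaloisRepOf (geomPoints W) ℓ h).fixedSubmodule
      (𝔓.inertia (absoluteGaloisGroup K)))
    rw [W.finrank_rationalTateModule_geomPoints_eq_two ℓ] at this
    omega
  refine Representation.toCoinvariants_eq_smul_id_of_finrank_invariants_eq_one _ _
    (W.finrank_rationalTateModule_geomPoints_eq_two ℓ)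
    (fun s ↦ W.det_restrictDecomposition_inertia_eq_one ℓ h hℓ h𝔓 s) h1 σ ha0 ?_ hdetσ
  intro e he
  rw [ContinuousRep.invariants_restrictDecomposition_comp_inertia] at he
  exact ha e he

end Coinvariants

/-! ### The additive-place fact of `HasseWeilAbelianBadReduction` from Thm. IV.10.2(a) -/

/-- **Additive reduction: `(V_ℓ E)_{I_𝔓} = 0` from Thm. IV.10.2(a).**  The named fact
`inertiaCoinvariants_rationalTate_eq_zero_of_hasAdditiveReductionAt W ℓ`
(`HasseWeilAbelianBadReduction`) follows from the additive case of Silverman *ATAEC*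
Thm. IV.10.2(a), `codim (V_ℓ E)^{I_𝔓} = 2`
(`codimFixed_inertia_rationalTate_eq_two_of_hasAdditiveReductionAt W ℓ`, `HasseWeilAbelianConductor`),
by `dim (V_ℓ E)_{I} = dim (V_ℓ E)^{I}` (`finrank_inertiaCoinvariants_eq_two_sub_codimFixed`; Weil
pairing, *AEC* III.8.1, III.8.3, proved in the tree).
[cite: SilvermanATAEC1994, §IV.10 Definition and Thm. 10.2(a) (PDF p. 358)] -/
theorem inertiaCoinvariants_rationalTate_eq_zero_of_hasAdditiveReductionAt_of_codim
    (hTa : W.codimFixed_inertia_rationalTate_eq_two_of_hasAdditiveReductionAt ℓ) :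
    W.inertiaCoinvariants_rationalTate_eq_zero_of_hasAdditiveReductionAt ℓ := by
  intro _ h v hℓ hv 𝔓 h𝔓
  rw [W.finrank_inertiaCoinvariants_eq_two_sub_codimFixed ℓ h hℓ h𝔓, hTa h v hℓ hv h𝔓]

end WeierstrassCurve

end
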